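import Literature.MathematicalPhysics.QuantumLattice.HubbardTorusFlux
import Literature.MathematicalPhysics.QuantumLattice.MagneticHubbardTorusTrivialField
import HarnessLib

/-!
# The flux-threaded Hubbard torus as a Peierls Hamiltonian: seam gauge and uniform gauge

Topic `Literature/MathematicalPhysics/QuantumLattice` (family `hubbard`); companion of
`HubbardTorusFlux.lean` (route `FluxSpectroscopy` of `HubbardSuperconductivity`, items FluxBridge …
BlochBound) and of `MagneticHubbardTorus.lean` (route `ChernVortexResponse`).

## Contents

* `seamFluxConfig L θ : GaugeConfig 2 L Circle` — the lattice `U(1)` gauge field carrying the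
  Aharonov–Bohm flux `θ` on the seam edges `((-1, y), e₁)` only (phase `e^{iθ}` on the hop
  `(-1,y) → (0,y)`), all other edges trivial;
  `uniformTwistConfig L θ` — the same flux spread uniformly, phase `e^{iθ/L}` on EVERY `e₁`-edge;
  `twistGauge L θ x = e^{-iθ x₁/L}` (`x₁ ∈ {0,…,L-1}` the canonical representative) — the site gauge
  transformation relating them (the Lieb–Schultz–Mattis / Bloch twist, Watanabe 2019 §2.2.3, §4.1).
* PROVED: `magneticHubbardTorus L (seamFluxConfig L θ) t U = magneticHubbardTorus L 1 t U + t • seamTwist L θ`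
  (all `L ≥ 1`); hence, with `magneticHubbardTorus_one_eq_hubbardTorus`,
  **`hubbardTorusFlux L U θ = magneticHubbardTorus L (seamFluxConfig L θ) 1 U` for `L ≥ 3`**
  (`hubbardTorusFlux_eq_magneticHubbardTorus`): the seam-twisted torus of route `FluxSpectroscopy`
  is the Peierls-coupled torus of route `ChernVortexResponse` in the seam gauge; and the lattice
  gauge identity **`gaugeTransform (twistGauge L θ) (seamFluxConfig L θ) = uniformTwistConfig L θ`**
  for `L ≥ 2` (`gaugeTransform_twistGauge_seamFluxConfig`; Watanabe 2019 eq. `U_m† H U_m = H^{(2πm/L,…)}`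
  at the level of the gauge field: the seam phase `e^{iθ}` times `e^{-iθ(L-1)/L}` is `e^{iθ/L}`).
* NOT here: the operator identity `H_{gaugeTransform g A} = W_gᴴ H_A W_g` and the equality of the
  sector energies of `hubbardTorusFlux L U θ` and of the uniformly twisted torus, which follow from
  the two results above and the gauge covariance of `magneticHubbardTorus`
  (`MagneticHubbardTorusGauge.lean`, companion of `MagneticHubbardTorus.lean`).

## Design notes

`L = 1, 2`: the gauge-field identities hold for `L ≥ 2` (`L = 1` is excluded only because
`(1 : ZMod 1).val = 0` breaks the bookkeeping), the identification with `hubbardTorusFlux` needs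
`L ≥ 3` exactly as `magneticHubbardTorus_one_eq_hubbardTorus` does (for `L = 2` the edge sum of the
magnetic torus double counts the bonds of the simple torus graph).

## References

H. Watanabe, J. Stat. Phys. 177 (2019) 717, §2.2.3 (seam-twisted Hamiltonian and the gauge
identity), §4.1 (two dimensions) [Watanabe2019]; Y. Tada, T. Koma, J. Stat. Phys. 165 (2016) 455,
§4 (`t̃_{x,y}(A) = t_{x,y} e^{iA_{x,y}}`, `A' = A ∓ θ` under `e^{iθ n_u}`) [TadaKoma2016]; E. H. Lieb,
PRL 73 (1994) 2158, eq. (1) [Lieb1994].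
-/

noncomputable section

namespace Literature.MathematicalPhysics.QuantumLattice

open Matrix Finset Literature.MathematicalPhysics.QuantumFieldTheory
open scoped ComplexConjugate

variable (L : ℕ)

/-! ### The seam and uniform gauge fields and the twist gauge -/

/-- The **seam gauge field** with flux `θ`: the `U(1)` lattice gauge configuration on `(ℤ/L)²`
equal to `e^{iθ}` on the `e₁`-edges leaving the column `x₁ = -1` (the hops `(-1,y) → (0,y)` across
the seam) and `1` on all other edges. Its only non-trivial holonomy is `e^{iθ}` around the
`e₁`-cycle (every plaquette is flat). Watanabe (2019) §2.2.3 (twisted boundary condition localised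
at the seam). [cite: Watanabe2019, §2.2.3 and §4.1] -/
def seamFluxConfig (θ : ℝ) : GaugeConfig 2 L Circle :=
  fun e => if e.2 = 0 ∧ e.1 0 = -1 then Circle.exp θ else 1

/-- The **uniformly twisted gauge field** with total flux `θ`: phase `e^{iθ/L}` on every `e₁`-edge
`(x, x + e₁)`, `1` on the `e₂`-edges (Watanabe 2019: `U_m† H U_m = H^{(2πm/L, …, 2πm/L)}`, the
twist spread over all seams). [cite: Watanabe2019, §2.2.3 and §4.1] -/
def uniformTwistConfig (θ : ℝ) : GaugeConfig 2 L Circle :=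
  fun e => if e.2 = 0 then Circle.exp (θ / L) else 1

/-- The **twist gauge** `g_x = e^{-iθ x₁/L}` (`x₁ = (x 0).val ∈ {0, …, L-1}`), the lattice gauge
transformation conjugating the seam field into the uniform one; as an operator on Fock space it is
the Lieb–Schultz–Mattis twist `exp[-i(θ/L) Σ_x x₁ n_x]` (Watanabe 2019 §2.2.1, §4.1).
[cite: Watanabe2019, §2.2.1 (twist operator U_m)] -/
def twistGauge (θ : ℝ) (x : Site 2 L) : Circle :=
  Circle.exp (-(θ / L * ((x 0).val : ℝ)))

/-- `seamFluxConfig` on an edge, unfolded. [folklore] -/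
theorem seamFluxConfig_apply (θ : ℝ) (x : Site 2 L) (i : Fin 2) :
    seamFluxConfig L θ (x, i) = if i = 0 ∧ x 0 = -1 then Circle.exp θ else 1 := rfl

/-- `uniformTwistConfig` on an edge, unfolded. [folklore] -/
theorem uniformTwistConfig_apply (θ : ℝ) (x : Site 2 L) (i : Fin 2) :
    uniformTwistConfig L θ (x, i) = if i = 0 then Circle.exp (θ / L) else 1 := rfl

/-- At zero flux the seam field is trivial. [folklore] -/
@[simp] theorem seamFluxConfig_zero : seamFluxConfig L 0 = 1 := by
  funext e
  simp [seamFluxConfig]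

/-! ### `ZMod` bookkeeping at the seam -/

variable {L}

/-- In `ℤ/L` (`L ≥ 1`): `a = -1` iff the canonical representative of `a` is `L - 1`. [folklore] -/
theorem zmod_eq_neg_one_iff_val [NeZero L] (a : ZMod L) : a = -1 ↔ a.val + 1 = L := by
  obtain ⟨n, rfl⟩ : ∃ n, L = n + 1 := ⟨L - 1, (Nat.succ_pred_eq_of_pos (NeZero.pos L)).symm⟩
  constructor
  · rintro rfl
    rw [ZMod.val_neg_one]
  · intro h
    have hv : a.val = n := by omega
    rw [← ZMod.natCast_zmod_val a, hv]
    have h0 : ((n : ℕ) : ZMod (n + 1)) + 1 = 0 := by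
      exact_mod_cast ZMod.natCast_self (n + 1)
    exact eq_neg_of_add_eq_zero_left h0

/-- Off the seam the representative of `a + 1` is `a.val + 1` (`L ≥ 2`). [folklore] -/
theorem zmod_val_add_one_of_ne_neg_one (hL : 2 ≤ L) {a : ZMod L} (ha : a ≠ -1) :
    (a + 1).val = a.val + 1 := by
  haveI : NeZero L := ⟨by omega⟩
  haveI : Fact (1 < L) := ⟨by omega⟩
  have hlt : a.val + 1 < L := by
    have h1 := ZMod.val_lt a
    have h2 : a.val + 1 ≠ L := fun h => ha ((zmod_eq_neg_one_iff_val a).2 h)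
    omega
  rw [ZMod.val_add_of_lt (by rwa [ZMod.val_one]), ZMod.val_one]

/-- The `e₁`-shift moves the first coordinate by one and fixes the second. [folklore] -/
theorem shift_zero_apply_zero (x : Site 2 L) : (x.shift 0) 0 = x 0 + 1 := by
  simp [Site.shift]

/-- The `e₂`-shift fixes the first coordinate. [folklore] -/
theorem shift_one_apply_zero (x : Site 2 L) : (x.shift 1) 0 = x 0 := by
  simp [Site.shift]

/-- The seam column shifted by `e₁` is the column `x₁ = 0`: `![-1, y] + e₁ = ![0, y]`. [folklore] -/
theorem shift_seam_column (y : ZMod L) : Site.shift (![-1, y] : Site 2 L) 0 = ![0, y] := by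
  funext i
  fin_cases i <;> simp [Site.shift]

/-! ### The lattice gauge identity: seam field ∼ uniform field -/

/-- **Spreading the seam flux.** The twist gauge `g_x = e^{-iθx₁/L}` transforms the seam field into
the uniform one: `g_x · A^{seam}(x, e₁) · g_{x+e₁}⁻¹ = e^{iθ/L}` on every `e₁`-edge (off the seam
`e^{-iθx₁/L} e^{iθ(x₁+1)/L}`, on the seam `e^{-iθ(L-1)/L} e^{iθ} e^{0}`), and `= 1` on `e₂`-edges
(`L ≥ 2`). Watanabe (2019) §2.2.3 (`U_m† H U_m = H^{(2πm/L,…,2πm/L)}` via repeated use of the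
one-seam gauge identity); Tada–Koma (2016) §4 (`A' = A ∓ θ`). [cite: Watanabe2019, §2.2.3 and §4.1] -/
theorem gaugeTransform_twistGauge_seamFluxConfig (hL : 2 ≤ L) (θ : ℝ) :
    gaugeTransform (twistGauge L θ) (seamFluxConfig L θ) = uniformTwistConfig L θ := by
  haveI : NeZero L := ⟨by omega⟩
  have hL0 : (L : ℝ) ≠ 0 := by exact_mod_cast (NeZero.ne L)
  funext ⟨x, i⟩
  simp only [gaugeTransform, seamFluxConfig_apply, uniformTwistConfig_apply, twistGauge]
  fin_cases i
  · simp only [Fin.zero_eta, Fin.isValue, true_and, if_true, shift_zero_apply_zero]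
    by_cases hx : x 0 = -1
    · have hv : ((x 0).val : ℝ) = L - 1 := by
        have h := (zmod_eq_neg_one_iff_val (x 0)).1 hx
        have h' : (((x 0).val + 1 : ℕ) : ℝ) = L := by exact_mod_cast h
        push_cast at h'
        linarith
      have hx0 : x 0 + 1 = 0 := by rw [hx, neg_add_cancel]
      rw [if_pos hx, hx0, ZMod.val_zero, hv, Nat.cast_zero, mul_zero, neg_zero, Circle.exp_zero,
        inv_one, mul_one, ← Circle.exp_add]
      congr 1
      field_simp
      ring
    · rw [if_neg hx, mul_one, zmod_val_add_one_of_ne_neg_one hL hx, ← Circle.exp_neg,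
        ← Circle.exp_add]
      congr 1
      push_cast
      field_simp
      ring
  · simp only [Fin.mk_one, Fin.isValue, one_ne_zero, false_and, if_false, mul_one,
      shift_one_apply_zero, mul_inv_cancel]

/-! ### The seam-twisted torus is the magnetic torus in the seam gauge -/

variable [NeZero L]

/-- Sum over the seam column: `Σ_{x : (ℤ/L)², x₁ = -1} F x = Σ_y F (-1, y)`. [folklore] -/
theorem sum_site_ite_apply_zero_eq {M : Type*} [AddCommMonoid M] (F : Site 2 L → M) (a : ZMod L) :
    (∑ x : Site 2 L, if x 0 = a then F x else 0) = ∑ y : ZMod L, F ![a, y] := by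
  rw [← Fintype.sum_equiv (finTwoArrowEquiv (ZMod L)).symm
    (fun p : ZMod L × ZMod L => if p.1 = a then F ![p.1, p.2] else 0) _
    (fun p => by simp [finTwoArrowEquiv_symm_apply])]
  rw [Fintype.sum_prod_type]
  simp only [Finset.sum_ite_irrel, Finset.sum_const_zero, Finset.sum_ite_eq', Finset.mem_univ,
    if_true]

/-- The seam twist of `HubbardTorusFlux.lean` written as an edge sum over the seam column of
`(ℤ/L)²` with the Peierls coefficients `1 - e^{iθ}`, `1 - e^{-iθ}`. [folklore] -/
theorem seamTwist_eq_sum_site (θ : ℝ) :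
    seamTwist L θ = ∑ x : Site 2 L, ∑ σ : Fin 2, if x 0 = -1 then
      ((1 - ((Circle.exp θ : Circle) : ℂ)) •
          (creation (orb (FermionTorus.ofTorusSite (x.shift 0)) σ) *
            annihilation (orb (FermionTorus.ofTorusSite x) σ)) +
        (1 - conj ((Circle.exp θ : Circle) : ℂ)) •
          (creation (orb (FermionTorus.ofTorusSite x) σ) *
            annihilation (orb (FermionTorus.ofTorusSite (x.shift 0)) σ)) :
        Matrix (Finset (Orb (FermionTorus 2 L))) (Finset (Orb (FermionTorus 2 L))) ℂ)
      else 0 := by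
  simp only [Finset.sum_ite_irrel, Finset.sum_const_zero]
  rw [sum_site_ite_apply_zero_eq, seamTwist]
  refine Finset.sum_congr rfl fun y _ => Finset.sum_congr rfl fun σ _ => ?_
  rw [Fintype.sum_bool, shift_seam_column]
  simp only [if_true, Bool.false_eq_true, if_false]
  have h1 : Complex.exp (1 * Complex.I * θ) = ((Circle.exp θ : Circle) : ℂ) := by
    rw [Circle.coe_exp, one_mul, mul_comm]
  have h2 : Complex.exp (-1 * Complex.I * θ) = conj ((Circle.exp θ : Circle) : ℂ) := by
    rw [Circle.coe_exp, ← Complex.exp_conj, map_mul, Complex.conj_ofReal, Complex.conj_I]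
    congr 1
    ring
  rw [h1, h2]

/-- The Peierls edge sums of the trivial and of the seam field differ by the seam twist (as an
edge sum over the seam column). [folklore] -/
theorem magneticHopping_one_sub_seamFluxConfig (θ : ℝ) :
    (∑ x : Site 2 L, ∑ i : Fin 2, ∑ σ : Fin 2,
        ((((1 : GaugeConfig 2 L Circle) (x, i) : Circle) : ℂ) •
            (creation (orb (FermionTorus.ofTorusSite (Site.shift x i)) σ) *
              annihilation (orb (FermionTorus.ofTorusSite x) σ)) +
          conj (((1 : GaugeConfig 2 L Circle) (x, i) : Circle) : ℂ) •
            (creation (orb (FermionTorus.ofTorusSite x) σ) *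
              annihilation (orb (FermionTorus.ofTorusSite (Site.shift x i)) σ)) :
          Matrix (Finset (Orb (FermionTorus 2 L))) (Finset (Orb (FermionTorus 2 L))) ℂ)) -
      (∑ x : Site 2 L, ∑ i : Fin 2, ∑ σ : Fin 2,
        (((seamFluxConfig L θ (x, i) : Circle) : ℂ) •
            (creation (orb (FermionTorus.ofTorusSite (Site.shift x i)) σ) *
              annihilation (orb (FermionTorus.ofTorusSite x) σ)) +
          conj ((seamFluxConfig L θ (x, i) : Circle) : ℂ) •
            (creation (orb (FermionTorus.ofTorusSite x) σ) *
              annihilation (orb (FermionTorus.ofTorusSite (Site.shift x i)) σ)))) =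
      ∑ x : Site 2 L, ∑ σ : Fin 2, if x 0 = -1 then
        ((1 - ((Circle.exp θ : Circle) : ℂ)) •
            (creation (orb (FermionTorus.ofTorusSite (x.shift 0)) σ) *
              annihilation (orb (FermionTorus.ofTorusSite x) σ)) +
          (1 - conj ((Circle.exp θ : Circle) : ℂ)) •
            (creation (orb (FermionTorus.ofTorusSite x) σ) *
              annihilation (orb (FermionTorus.ofTorusSite (x.shift 0)) σ)) :
          Matrix (Finset (Orb (FermionTorus 2 L))) (Finset (Orb (FermionTorus 2 L))) ℂ)
        else 0 := by
  rw [← Finset.sum_sub_distrib]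
  refine Finset.sum_congr rfl fun x _ => ?_
  rw [← Finset.sum_sub_distrib, Fin.sum_univ_two]
  have h1 : seamFluxConfig L θ (x, 1) = 1 := by simp [seamFluxConfig_apply]
  simp only [h1, Pi.one_apply, Circle.coe_one, map_one, one_smul, sub_self, add_zero,
    ← Finset.sum_sub_distrib]
  refine Finset.sum_congr rfl fun σ _ => ?_
  by_cases hx : x 0 = -1
  · rw [if_pos hx, seamFluxConfig_apply, if_pos ⟨rfl, hx⟩, sub_smul, sub_smul, one_smul, one_smul]
    abel
  · rw [if_neg hx, seamFluxConfig_apply, if_neg (fun h => hx h.2), Circle.coe_one, map_one, one_smul,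
      one_smul, sub_self]

/-- **The seam gauge.** Switching on the seam field adds `t • seamTwist L θ` to the magnetic Hubbard
torus with trivial field: `H_{A^{seam}_θ}(t, U) = H_1(t, U) + t Σ_{y,σ} [(1 - e^{iθ}) c†_{(0,y)σ} c_{(-1,y)σ}
+ (1 - e^{-iθ}) c†_{(-1,y)σ} c_{(0,y)σ}]` (every `L ≥ 1`). [folklore] -/
theorem magneticHubbardTorus_seamFluxConfig (θ t U : ℝ) :
    magneticHubbardTorus L (seamFluxConfig L θ) t U =
      magneticHubbardTorus L 1 t U + (t : ℂ) • seamTwist L θ := by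
  rw [magneticHubbardTorus, magneticHubbardTorus, seamTwist_eq_sum_site,
    ← magneticHopping_one_sub_seamFluxConfig]
  module

/-- **The flux-threaded torus is a Peierls Hamiltonian** (`L ≥ 3`): the seam-twisted Hubbard torus
`hubbardTorusFlux L U θ` of route `FluxSpectroscopy` is the magnetic Hubbard torus (`t = 1`) in the
seam gauge field `seamFluxConfig L θ`. Watanabe (2019) §2.2.3; Tada–Koma (2016) §4.
[cite: Watanabe2019, §2.2.3 and §4.1] -/
theorem hubbardTorusFlux_eq_magneticHubbardTorus (hL : 3 ≤ L) (U θ : ℝ) :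
    hubbardTorusFlux L U θ = magneticHubbardTorus L (seamFluxConfig L θ) 1 U := by
  rw [magneticHubbardTorus_seamFluxConfig, magneticHubbardTorus_one_eq_hubbardTorus hL,
    hubbardTorusFlux_eq, Complex.ofReal_one, one_smul]

/-- Hence the flux envelope of route `FluxSpectroscopy` is a sector energy of the magnetic torus in
the seam gauge (`L ≥ 3`). [folklore] -/
theorem fluxEnergy_eq_minEnergyOn_magneticHubbardTorus (hL : 3 ≤ L) (U δ θ : ℝ) :
    fluxEnergy L U δ θ =
      (magneticHubbardTorus L (seamFluxConfig L θ) 1 U).minEnergyOn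
        (szSector (2 * ⌊(1 - δ) * (L : ℝ) ^ 2 / 2⌋₊) 0) := by
  rw [fluxEnergy_eq, hubbardTorusFlux_eq_magneticHubbardTorus hL]

end Literature.MathematicalPhysics.QuantumLattice
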